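import Mathlib
import HarnessLib
import Summits.Langlands.Langlands.Theses.E8QuinticResidue
import Literature.NumberTheory.GaloisRepresentations.FramedRepTwist
import Literature.NumberTheory.GaloisRepresentations.TateTwistFrobeniusProofs
import Literature.RepresentationTheory.Semisimple.Twist

/-!
# Line `shadow-sign` for crux NoChimeras (stmt-Langlands-11145) — skeleton (crux-strategist)

Crux `NoChimeras` (stmt-Langlands-11145, route-Langlands-E8QuinticResidue, rank 3): for a Booker pair
`(π, π')` tempered a.e., any quintic field `K` with the mock-Frobenius splitting pattern forces
`π = π(σ)` for an irreducible icosahedral `σ : Γ_ℚ → GL₂(ℂ)` (Satake–Frobenius matching a.e.).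

The crux is cut along the centre of `2.A₅ = SL₂(F₅)`: the two genuine characters of `2.A₅` of
degree `2` restricted to a lift of the projective `A₅`-representation of `Gal(K̃/ℚ)` are pinned by
the splitting pattern of `K` and `λ_π` only UP TO A PLACE-WISE SIGN `ε(v) ∈ {±1}` (the lifts of a
projective representation to `SL₂(ℂ)` form a torsor under quadratic characters, and `λ = 0` places
see no sign at all).  Hence two pieces, typed fact-free over the cone of
`Summits.Langlands.Statement` exactly like the parent:

* **X1 `IcosahedralShadow`** (crux) — every Booker pair with Booker's alphabet and a quintic field
  `K` with the pattern has an irreducible icosahedral `σ₀` with, at a.e. `v`, a Satake parameter `α`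
  of `π`, `σ₀` unramified, and `charpoly σ₀(Frob_v) = ∏_{a ∈ α} (X - e_v a)` for some `e_v`,
  `e_v² = 1` ("adjoint-level reciprocity given the field": `Gal(K̃/ℚ) ≅ A₅`, liftability to
  `SL₂(ℂ)` — Serre's obstruction — and the `5A/5B` choice are its content);
* **X2 `ShadowSignLaw`** (crux) — for every such shadow `σ₀` the sign is interpolated by a continuous
  character `χ : Γ_ℚ →ₜ* ℂˣ`, trivial on the inertia above a.e. `v` and equal to `e_v` on the
  arithmetic Frobenii above `v` (the automorphic analogue is Ramakrishnan's multiplicity one for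
  `SL(2)`: `Ad π ≅ Ad π' ⇒ π' ≅ π ⊗ χ`).

**Assembly** (`…_of…` below, proved, axioms `propext/Classical.choice/Quot.sound`): (1) Booker's
alphabet `λ_π(v) ∈ {0, ±1, ±2, ±φ, ±φ^τ}` is DERIVED at a.e. place from temperedness and the
`ℤ[φ]`-shape of the eigenvalues (`alphabet_of_norm_eq_one`, an inequality argument with `√5 > 2`),
so the pieces may assume it; (2) X1 gives `σ₀`, (3) X2 gives `χ`, (4) the witness of `NoChimeras` is
CONSTRUCTED as the twist `σ := σ₀ ⊗ χ` (`FramedRep.twist`), and one proves it is irreducible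
(`isIrreducible_toGaloisRep_twist`), has the same image in `PGL₂(ℂ)` hence is icosahedral
(`range_mk_comp_twist`), is unramified wherever `σ₀` and `χ` are
(`FramedGaloisRep.isUnramifiedAt_twist`) and has `charpoly σ(Frob_v) = satakePolynomial α` because
`e_v² = 1` (`hasFrobCharpolyAt_twist_satake`, via `FramedGaloisRep.hasFrobCharpolyAt_twist_of_eq_prod`).
Neither piece alone gives the crux (X1 leaves the sign law, X2 needs a shadow), neither mentions the
summit; the same cut was proposed independently for the Galois → automorphic direction by the
idea-node card `adjoint-signlaw-splitting` (evidence card-11145.md / Rungs.lean on the item).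

Registered stubs: `stub_icosahedralShadow` (X1), `stub_signLaw` (X2); composition `NoChimeras_of`
(real proof) and `NoChimeras_proof`.  Sorries ONLY inside the two stubs.
-/

noncomputable section

open scoped NumberField
open IsDedekindDomain Field Polynomial Filter
open Literature.NumberTheory.GaloisRepresentations Literature.NumberTheory.Automorphic

-- `Summit.Langlands.Langlands.…`: summit = sub-problem name (D-0017 nested layout), not a typo.
set_option linter.dupNamespace false

namespace Summit.Langlands.Langlands.Cruxes.NoChimeras.ShadowSign

/-! ### The two stubs (= the pieces X1, X2 of the split) -/

/-- **Stub X1 — `IcosahedralShadow`** (crux): icosahedral shadow of `π` matching up to a place-wise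
sign, built from the quintic field `K`. Open (adjoint-level reciprocity given the field).
[cite: Booker2018, Thm. 1] [cite: Kim2004, §1] -/
theorem stub_icosahedralShadow : ∀ (hcpt : Literature.NumberTheory.Automorphic.isCompact_glFiniteIntegralLevel 2 ℚ) (π π' : Literature.NumberTheory.Automorphic.CuspidalAutomorphicRepData 2 ℚ hcpt), ¬ π.1.IsNearlyEquivalent π'.1 → (∀ (K : Type) [Field K] [NumberField K], Module.finrank ℚ K = 2 → ¬ ∀ᶠ v : IsDedekindDomain.HeightOneSpectrum (NumberField.RingOfIntegers ℚ) in Filter.cofinite, (Ideal.span {((v.residueCard : ℕ) : NumberField.RingOfIntegers K)}).IsPrime → ∀ α : Multiset ℂ, π.1.HasSatakeParamAt v α → π.1.HasSatakeParamAt v (α.map fun a => -a)) → (∀ (K : Type) [Field K] [NumberField K], Module.finrank ℚ K = 2 → ¬ ∀ᶠ v : IsDedekindDomain.HeightOneSpectrum (NumberField.RingOfIntegers ℚ) in Filter.cofinite, (Ideal.span {((v.residueCard : ℕ) : NumberField.RingOfIntegers K)}).IsPrime → ∀ α : Multiset ℂ, π'.1.HasSatakeParamAt v α → π'.1.HasSatakeParamAt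 v (α.map fun a => -a)) → (∀ᶠ v : IsDedekindDomain.HeightOneSpectrum (NumberField.RingOfIntegers ℚ) in Filter.cofinite, ∃ α α' : Multiset ℂ, π.1.HasSatakeParamAt v α ∧ π'.1.HasSatakeParamAt v α' ∧ α.prod = 1 ∧ α'.prod = 1 ∧ ∃ a b : ℤ, α.sum = (a : ℂ) + (b : ℂ) * ((1 + (Real.sqrt 5 : ℂ)) / 2) ∧ α'.sum = (a : ℂ) + (b : ℂ) * ((1 - (Real.sqrt 5 : ℂ)) / 2) ∧ ((b = 0 ∧ (a = 0 ∨ a = 1 ∨ a = -1 ∨ a = 2 ∨ a = -2)) ∨ (b = 1 ∧ (a = 0 ∨ a = -1)) ∨ (b = -1 ∧ (a = 0 ∨ a = 1)))) → (∀ᶠ v : IsDedekindDomain.HeightOneSpectrum (NumberField.RingOfIntegers ℚ) in Filter.cofinite, (∀ α : Multiset ℂ, π.1.HasSatakeParamAt v α → ∀ a ∈ α, ‖a‖ = 1) ∧ (∀ α' : Multiset ℂ, π'.1.HasSatakeParamAt v α' → ∀ a ∈ α', ‖a‖ = 1)) → ∀ (K : Type) [Field K] [NumberField K], Module.finrank ℚ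 K = 5 → (∀ᶠ v : IsDedekindDomain.HeightOneSpectrum (NumberField.RingOfIntegers ℚ) in Filter.cofinite, ∀ (α α' : Multiset ℂ) (a b : ℤ), π.1.HasSatakeParamAt v α → π'.1.HasSatakeParamAt v α' → α.sum = (a : ℂ) + (b : ℂ) * ((1 + (Real.sqrt 5 : ℂ)) / 2) → α'.sum = (a : ℂ) + (b : ℂ) * ((1 - (Real.sqrt 5 : ℂ)) / 2) → ∃ F : Multiset ℕ, (UniqueFactorizationMonoid.normalizedFactors (Ideal.span {((v.residueCard : ℕ) : NumberField.RingOfIntegers K)})).Nodup ∧ (UniqueFactorizationMonoid.normalizedFactors (Ideal.span {((v.residueCard : ℕ) : NumberField.RingOfIntegers K)})).map (fun P => Ideal.absNorm P) = F ∧ (b = 0 → (a = 2 ∨ a = -2) → F = Multiset.replicate 5 v.residueCard) ∧ (b = 0 → a = 0 → F = {v.residueCard ^ 2, v.residueCard ^ 2, v.residueCard}) ∧ (b = 0 → (a = 1 ∨ a = -1) → F = {v.residueCard ^ 3, v.residueCard, v.residueCard}) ∧ (((a = 0 ∧ (b = 1 ∨ b = -1)) ∨ (a = 1 ∧ b = -1)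 ∨ (a = -1 ∧ b = 1)) → F = {v.residueCard ^ 5})) → ∃ σ₀ : Literature.NumberTheory.GaloisRepresentations.FramedGaloisRep ℚ ℂ 2, σ₀.toGaloisRep.IsIrreducible ∧ Nonempty ((Matrix.ProjGenLinGroup.mk.comp σ₀.toMonoidHom).range ≃* alternatingGroup (Fin 5)) ∧ ∀ᶠ v : IsDedekindDomain.HeightOneSpectrum (NumberField.RingOfIntegers ℚ) in Filter.cofinite, ∃ α : Multiset ℂ, π.1.HasSatakeParamAt v α ∧ σ₀.IsUnramifiedAt v ∧ ∃ e : ℂ, e ^ 2 = 1 ∧ σ₀.HasFrobCharpolyAt v (Literature.NumberTheory.Automorphic.satakePolynomial (α.map fun a => e * a)) := by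
  sorry

/-- **Stub X2 — `ShadowSignLaw`** (crux): the place-wise sign between `π` and an icosahedral shadow is a
continuous a.e.-unramified character. Open (Galois-side analogue of multiplicity one for `SL(2)`).
[cite: Ramakrishnan2000, Thm. 4.1.1] [cite: MartinRamakrishnan2016, Thm. A] -/
theorem stub_signLaw : ∀ (hcpt : Literature.NumberTheory.Automorphic.isCompact_glFiniteIntegralLevel 2 ℚ) (π π' : Literature.NumberTheory.Automorphic.CuspidalAutomorphicRepData 2 ℚ hcpt), ¬ π.1.IsNearlyEquivalent π'.1 → (∀ (K : Type) [Field K] [NumberField K], Module.finrank ℚ K = 2 → ¬ ∀ᶠ v : IsDedekindDomain.HeightOneSpectrum (NumberField.RingOfIntegers ℚ) in Filter.cofinite, (Ideal.span {((v.residueCard : ℕ) : NumberField.RingOfIntegers K)}).IsPrime → ∀ α : Multiset ℂ, π.1.HasSatakeParamAt v α → π.1.HasSatakeParamAt v (α.map fun a => -a)) → (∀ (K : Type) [Field K] [NumberField K], Module.finrank ℚ K = 2 → ¬ ∀ᶠ v : IsDedekindDomain.HeightOneSpectrum (NumberField.RingOfIntegers ℚ) in Filter.cofinite, (Ideal.span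 {((v.residueCard : ℕ) : NumberField.RingOfIntegers K)}).IsPrime → ∀ α : Multiset ℂ, π'.1.HasSatakeParamAt v α → π'.1.HasSatakeParamAt v (α.map fun a => -a)) → (∀ᶠ v : IsDedekindDomain.HeightOneSpectrum (NumberField.RingOfIntegers ℚ) in Filter.cofinite, ∃ α α' : Multiset ℂ, π.1.HasSatakeParamAt v α ∧ π'.1.HasSatakeParamAt v α' ∧ α.prod = 1 ∧ α'.prod = 1 ∧ ∃ a b : ℤ, α.sum = (a : ℂ) + (b : ℂ) * ((1 + (Real.sqrt 5 : ℂ)) / 2) ∧ α'.sum = (a : ℂ) + (b : ℂ) * ((1 - (Real.sqrt 5 : ℂ)) / 2) ∧ ((b = 0 ∧ (a = 0 ∨ a = 1 ∨ a = -1 ∨ a = 2 ∨ a = -2)) ∨ (b = 1 ∧ (a = 0 ∨ a = -1)) ∨ (b = -1 ∧ (a = 0 ∨ a = 1)))) → (∀ᶠ v : IsDedekindDomain.HeightOneSpectrum (NumberField.RingOfIntegers ℚ) in Filter.cofinite, (∀ α : Multiset ℂ, π.1.HasSatakeParamAt v α → ∀ a ∈ α, ‖a‖ = 1) ∧ (∀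 α' : Multiset ℂ, π'.1.HasSatakeParamAt v α' → ∀ a ∈ α', ‖a‖ = 1)) → ∀ σ₀ : Literature.NumberTheory.GaloisRepresentations.FramedGaloisRep ℚ ℂ 2, σ₀.toGaloisRep.IsIrreducible → Nonempty ((Matrix.ProjGenLinGroup.mk.comp σ₀.toMonoidHom).range ≃* alternatingGroup (Fin 5)) → (∀ᶠ v : IsDedekindDomain.HeightOneSpectrum (NumberField.RingOfIntegers ℚ) in Filter.cofinite, ∃ α : Multiset ℂ, π.1.HasSatakeParamAt v α ∧ σ₀.IsUnramifiedAt v ∧ ∃ e : ℂ, e ^ 2 = 1 ∧ σ₀.HasFrobCharpolyAt v (Literature.NumberTheory.Automorphic.satakePolynomial (α.map fun a => e * a))) → ∃ χ : Field.absoluteGaloisGroup ℚ →ₜ* ℂˣ, ∀ᶠ v : IsDedekindDomain.HeightOneSpectrum (NumberField.RingOfIntegers ℚ) in Filter.cofinite, ∃ α : Multiset ℂ, π.1.HasSatakeParamAt v α ∧ σ₀.IsUnramifiedAt v ∧ (∀ 𝔓 ∈ v.primesAbove, ∀ g ∈ 𝔓.inertia (Field.absoluteGaloisGroup ℚ), χ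 g = 1) ∧ ∃ e : ℂ, e ^ 2 = 1 ∧ (∀ 𝔓 ∈ v.primesAbove, ∀ g : Field.absoluteGaloisGroup ℚ, IsArithFrobAt (NumberField.RingOfIntegers ℚ) g 𝔓 → ((χ g : ℂˣ) : ℂ) = e) ∧ σ₀.HasFrobCharpolyAt v (Literature.NumberTheory.Automorphic.satakePolynomial (α.map fun a => e * a)) := by
  sorry

/-! ### Booker's alphabet from temperedness (elementary; proved here) -/

/-- **Booker's alphabet from temperedness.** If `α`, `α'` are pairs of complex numbers of norm
one (tempered Satake parameters) with sums `a + bφ` and `a + bφ^τ` (`a b : ℤ`, `φ = (1+√5)/2`),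
then `(a, b)` is one of the nine pairs giving `λ ∈ A = {0, ±1, ±2, ±φ, ±φ^τ}`: `|b|√5 ≤ 4 < 2√5`
forces `|b| ≤ 1`, and then `|a + bφ|, |a + bφ^τ| ≤ 2` pin `a`.
[cite: Booker2018, Thm. 1 (3b): the alphabet A] -/
theorem alphabet_of_norm_eq_one {α α' : Multiset ℂ} (hc : Multiset.card α = 2)
    (hc' : Multiset.card α' = 2) (hn : ∀ x ∈ α, ‖x‖ = 1) (hn' : ∀ x ∈ α', ‖x‖ = 1) {a b : ℤ}
    (hs : α.sum = (a : ℂ) + (b : ℂ) * ((1 + (Real.sqrt 5 : ℂ)) / 2))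
    (hs' : α'.sum = (a : ℂ) + (b : ℂ) * ((1 - (Real.sqrt 5 : ℂ)) / 2)) :
    (b = 0 ∧ (a = 0 ∨ a = 1 ∨ a = -1 ∨ a = 2 ∨ a = -2)) ∨ (b = 1 ∧ (a = 0 ∨ a = -1)) ∨
      (b = -1 ∧ (a = 0 ∨ a = 1)) := by
  -- the norm of a sum of two unit complex numbers is at most 2
  have key : ∀ β : Multiset ℂ, Multiset.card β = 2 → (∀ x ∈ β, ‖x‖ = 1) → ‖β.sum‖ ≤ 2 := by
    intro β hβ hβn
    have h1 : ‖β.sum‖ ≤ (β.map fun x => ‖x‖).sum := norm_multiset_sum_le β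
    have h2 : (β.map fun x => ‖x‖) = β.map fun _ => (1 : ℝ) := Multiset.map_congr rfl hβn
    rw [h2, Multiset.map_const', Multiset.sum_replicate, hβ] at h1
    norm_num at h1
    exact h1
  have h5 : (2 : ℝ) < Real.sqrt 5 := by
    rw [show (2 : ℝ) = Real.sqrt 4 by
      rw [show (4 : ℝ) = 2 ^ 2 by norm_num, Real.sqrt_sq (by norm_num : (0 : ℝ) ≤ 2)]]
    exact Real.sqrt_lt_sqrt (by norm_num) (by norm_num)
  set s : ℝ := Real.sqrt 5 with hsdef
  have hr : ‖α.sum‖ = |(a : ℝ) + (b : ℝ) * ((1 + s) / 2)| := by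
    rw [hs, show (a : ℂ) + (b : ℂ) * ((1 + (s : ℂ)) / 2) =
      (((a : ℝ) + (b : ℝ) * ((1 + s) / 2) : ℝ) : ℂ) by push_cast; ring]
    rw [Complex.norm_real, Real.norm_eq_abs]
  have hr' : ‖α'.sum‖ = |(a : ℝ) + (b : ℝ) * ((1 - s) / 2)| := by
    rw [hs', show (a : ℂ) + (b : ℂ) * ((1 - (s : ℂ)) / 2) =
      (((a : ℝ) + (b : ℝ) * ((1 - s) / 2) : ℝ) : ℂ) by push_cast; ring]
    rw [Complex.norm_real, Real.norm_eq_abs]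
  have hA := key α hc hn
  have hA' := key α' hc' hn'
  rw [hr] at hA
  rw [hr'] at hA'
  rw [abs_le] at hA hA'
  obtain ⟨hA1, hA2⟩ := hA
  obtain ⟨hA1', hA2'⟩ := hA'
  -- |b| √5 ≤ 4 < 2 √5, hence |b| ≤ 1
  have hbu : (b : ℝ) < 2 := by nlinarith
  have hbl : (-2 : ℝ) < b := by nlinarith
  have hbu' : b < 2 := by exact_mod_cast hbu
  have hbl' : -2 < b := by exact_mod_cast hbl
  have hau : (a : ℝ) ≤ 2 - (b : ℝ) * ((1 + s) / 2) := by linarith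
  have hal : (-2 : ℝ) - (b : ℝ) * ((1 - s) / 2) ≤ a := by linarith
  interval_cases b
  · -- b = -1 : a ∈ {0, 1}
    have h1 : (a : ℝ) < 2 := by push_cast at hau hal ⊢; nlinarith
    have h2 : (-1 : ℝ) < a := by push_cast at hau hal ⊢; nlinarith
    have h1' : a < 2 := by exact_mod_cast h1
    have h2' : -1 < a := by exact_mod_cast h2
    right; right
    refine ⟨rfl, ?_⟩
    omega
  · -- b = 0 : |a| ≤ 2
    have h1 : (a : ℝ) ≤ 2 := by push_cast at hau; linarith
    have h2 : (-2 : ℝ) ≤ a := by push_cast at hal; linarith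
    have h1' : a ≤ 2 := by exact_mod_cast h1
    have h2' : -2 ≤ a := by exact_mod_cast h2
    left
    refine ⟨rfl, ?_⟩
    omega
  · -- b = 1 : a ∈ {0, -1}
    have h1 : (a : ℝ) < 1 := by push_cast at hau hal ⊢; nlinarith
    have h2 : (-2 : ℝ) < a := by push_cast at hau hal ⊢; nlinarith
    have h1' : a < 1 := by exact_mod_cast h1
    have h2' : -2 < a := by exact_mod_cast h2
    right; left
    refine ⟨rfl, ?_⟩
    omega

/-! ### Twists by continuous characters: projective image, irreducibility, Frobenius -/

/-- **Twisting by a character does not change the image in `PGL_n`**: scalars are central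
(`FramedRep.scalar_mul_comm`), hence die in `PGL_n = GL_n / Z` (`Matrix.ProjGenLinGroup.mk_eq_one`),
so `mk ((ρ ⊗ χ) g) = mk (ρ g)` for every `g`. [folklore] -/
theorem range_mk_comp_twist {G : Type*} [Group G] [TopologicalSpace G] {A : Type*} [CommRing A]
    [TopologicalSpace A] [IsTopologicalRing A] {n : ℕ} (ρ : FramedRep G A n) (χ : G →ₜ* Aˣ) :
    (Matrix.ProjGenLinGroup.mk.comp (FramedRep.twist ρ χ).toMonoidHom).range =
      (Matrix.ProjGenLinGroup.mk.comp ρ.toMonoidHom).range := by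
  have hsc : ∀ a : Aˣ, Matrix.ProjGenLinGroup.mk (FramedRep.scalar A n a) = 1 := by
    intro a
    rw [Matrix.ProjGenLinGroup.mk_eq_one, Subgroup.mem_center_iff]
    intro g
    exact (FramedRep.scalar_mul_comm a g).symm
  have key : ∀ g : G, Matrix.ProjGenLinGroup.mk (FramedRep.twist ρ χ g) =
      Matrix.ProjGenLinGroup.mk (ρ g) := by
    intro g
    rw [FramedRep.twist_apply, map_mul, hsc, one_mul]
  ext x
  simp only [MonoidHom.mem_range, MonoidHom.coe_comp, Function.comp_apply,
    ContinuousMonoidHom.coe_toMonoidHom]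
  constructor
  · rintro ⟨g, rfl⟩
    exact ⟨g, (key g).symm⟩
  · rintro ⟨g, rfl⟩
    exact ⟨g, key g⟩

/-- The representation underlying a framed twist `ρ ⊗ χ` is the twist of the underlying
representation (`(χ g • ρ g) *ᵥ v = χ g • (ρ g *ᵥ v)`, `Matrix.smul_mulVec`); adapted from
`Theorems/ParityBlindBianchiArtinWeightRealisationLevelStubIsIrreducibleTwistIff`. [folklore] -/
theorem toRepresentation_twist_eq {G : Type*} [Group G] [TopologicalSpace G] {A : Type*} [Field A]
    [TopologicalSpace A] [IsTopologicalRing A] {n : ℕ} (ρ : FramedRep G A n) (χ : G →ₜ* Aˣ) :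
    (FramedRep.twist ρ χ).toRepresentation =
      Literature.RepresentationTheory.Semisimple.Representation.twist ρ.toRepresentation
        (χ : G →* Aˣ) := by
  refine MonoidHom.ext fun g => LinearMap.ext fun v => ?_
  rw [FramedRep.toRepresentation_apply_apply, FramedRep.coe_twist_apply,
    Literature.RepresentationTheory.Semisimple.Representation.twist_apply_apply,
    FramedRep.toRepresentation_apply_apply, Matrix.smul_mulVec]
  rfl

/-- **Twisting by a continuous character preserves irreducibility** of the underlying Galois
representation (`toRepresentation_twist_eq` and
`Literature.RepresentationTheory.Semisimple.Representation.isIrreducible_twist_iff`: a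
representation and its twists have the same subrepresentations). [folklore] -/
theorem isIrreducible_toGaloisRep_twist {K : Type} [Field K] {A : Type} [Field A]
    [TopologicalSpace A] [IsTopologicalRing A] {n : ℕ} (ρ : FramedGaloisRep K A n)
    (χ : absoluteGaloisGroup K →ₜ* Aˣ) (h : ρ.toGaloisRep.IsIrreducible) :
    (FramedGaloisRep.toGaloisRep (FramedRep.twist ρ χ)).IsIrreducible := by
  change (FramedRep.twist ρ χ).toRepresentation.IsIrreducible
  rw [toRepresentation_twist_eq]
  exact (Literature.RepresentationTheory.Semisimple.Representation.isIrreducible_twist_iff _ _).mpr h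

/-- **Frobenius–Satake identity for the twist when the sign squares to one.** If the arithmetic
Frobenii above `v` have characteristic polynomial `satakePolynomial (e • α) = ∏ (X - e a)` on `σ₀`,
`χ` takes the value `e` on them, and `e² = 1`, then they have characteristic polynomial
`satakePolynomial α` on `σ₀ ⊗ χ` (`FramedGaloisRep.hasFrobCharpolyAt_twist_of_eq_prod` rescales
the roots by `e`, and `e · (e · a) = a`). [folklore] -/
theorem hasFrobCharpolyAt_twist_satake {v : HeightOneSpectrum (𝓞 ℚ)}
    {σ₀ : FramedGaloisRep ℚ ℂ 2} {α : Multiset ℂ} {e : ℂ} (he : e ^ 2 = 1)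
    (hcp : σ₀.HasFrobCharpolyAt v (satakePolynomial (α.map fun a => e * a)))
    {χ : absoluteGaloisGroup ℚ →ₜ* ℂˣ}
    (hχ : ∀ 𝔓 ∈ v.primesAbove, ∀ g : absoluteGaloisGroup ℚ, IsArithFrobAt (𝓞 ℚ) g 𝔓 →
      ((χ g : ℂˣ) : ℂ) = e) :
    FramedGaloisRep.HasFrobCharpolyAt v (satakePolynomial α) (FramedRep.twist σ₀ χ) := by
  have h := FramedGaloisRep.hasFrobCharpolyAt_twist_of_eq_prod (β := α.map fun a => e * a)
    (ρ := σ₀) (by simpa only [satakePolynomial] using hcp) hχ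
  have hee : ∀ a : ℂ, e * (e * a) = a := fun a => by
    rw [← mul_assoc, ← sq, he, one_mul]
  have hpoly : ((α.map fun a => e * a).map fun b => X - C (e * b)) = α.map fun a => X - C a := by
    rw [Multiset.map_map]
    refine Multiset.map_congr rfl fun a _ => ?_
    simp only [Function.comp_apply, hee]
  rw [hpoly] at h
  simpa only [satakePolynomial] using h

/-! ### Composition -/

/-- **The skeleton: `NoChimeras` from the two registered stubs, used by name** — the assembly
described in the module docstring (alphabet lemma, shadow, sign character, twist).  Becomes the
crux proof when both stubs are discharged; until then its only non-standard axiom is the `sorry`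
of the stubs.  The hypothesis form `IcosahedralShadow → ShadowSignLaw → NoChimeras` of the very same proof,
with NO stub in its cone, is `Theorems/E8QuinticResidueNoChimerasSplit.lean : NoChimeras_of_subs`
(rc 0, axioms propext/Classical.choice/Quot.sound; attached as evidence on the crux item for a prover
to land — planner seats cannot write under Theorems/). -/
theorem NoChimeras_of : Summit.Langlands.Langlands.Theses.E8QuinticResidue.NoChimeras := by
  have h1 := stub_icosahedralShadow
  have h2 := stub_signLaw
  revert h1 h2
  show (∀ (hcpt : Literature.NumberTheory.Automorphic.isCompact_glFiniteIntegralLevel 2 ℚ) (π π' : Literature.NumberTheory.Automorphic.CuspidalAutomorphicRepData 2 ℚ hcpt), ¬ π.1.IsNearlyEquivalent π'.1 → (∀ (K : Type) [Field K] [NumberField K], Module.finrank ℚ K = 2 → ¬ ∀ᶠ v : IsDedekindDomain.HeightOneSpectrum (NumberField.RingOfIntegers ℚ) in Filter.cofinite, (Ideal.span {((v.residueCard : ℕ) : NumberField.RingOfIntegers K)}).IsPrime → ∀ α : Multiset ℂ, π.1.HasSatakeParamAt v α → π.1.HasSatakeParamAt v (α.map fun a => -a)) → (∀ (K : Type) [Field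 K] [NumberField K], Module.finrank ℚ K = 2 → ¬ ∀ᶠ v : IsDedekindDomain.HeightOneSpectrum (NumberField.RingOfIntegers ℚ) in Filter.cofinite, (Ideal.span {((v.residueCard : ℕ) : NumberField.RingOfIntegers K)}).IsPrime → ∀ α : Multiset ℂ, π'.1.HasSatakeParamAt v α → π'.1.HasSatakeParamAt v (α.map fun a => -a)) → (∀ᶠ v : IsDedekindDomain.HeightOneSpectrum (NumberField.RingOfIntegers ℚ) in Filter.cofinite, ∃ α α' : Multiset ℂ, π.1.HasSatakeParamAt v α ∧ π'.1.HasSatakeParamAt v α' ∧ α.prod = 1 ∧ α'.prod = 1 ∧ ∃ a b : ℤ, α.sum = (a : ℂ) + (b : ℂ) * ((1 + (Real.sqrt 5 : ℂ)) / 2) ∧ α'.sum = (a : ℂ) + (b : ℂ) * ((1 - (Real.sqrt 5 : ℂ)) / 2) ∧ ((b = 0 ∧ (a = 0 ∨ a = 1 ∨ a = -1 ∨ a = 2 ∨ a = -2)) ∨ (b = 1 ∧ (a = 0 ∨ a = -1)) ∨ (b = -1 ∧ (a = 0 ∨ a = 1)))) → (∀ᶠ v : IsDedekindDomain.HeightOneSpectrum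 (NumberField.RingOfIntegers ℚ) in Filter.cofinite, (∀ α : Multiset ℂ, π.1.HasSatakeParamAt v α → ∀ a ∈ α, ‖a‖ = 1) ∧ (∀ α' : Multiset ℂ, π'.1.HasSatakeParamAt v α' → ∀ a ∈ α', ‖a‖ = 1)) → ∀ (K : Type) [Field K] [NumberField K], Module.finrank ℚ K = 5 → (∀ᶠ v : IsDedekindDomain.HeightOneSpectrum (NumberField.RingOfIntegers ℚ) in Filter.cofinite, ∀ (α α' : Multiset ℂ) (a b : ℤ), π.1.HasSatakeParamAt v α → π'.1.HasSatakeParamAt v α' → α.sum = (a : ℂ) + (b : ℂ) * ((1 + (Real.sqrt 5 : ℂ)) / 2) → α'.sum = (a : ℂ) + (b : ℂ) * ((1 - (Real.sqrt 5 : ℂ)) / 2) → ∃ F : Multiset ℕ, (UniqueFactorizationMonoid.normalizedFactors (Ideal.span {((v.residueCard : ℕ) : NumberField.RingOfIntegers K)})).Nodup ∧ (UniqueFactorizationMonoid.normalizedFactors (Ideal.span {((v.residueCard : ℕ) : NumberField.RingOfIntegers K)})).map (fun P => Ideal.absNorm P) = F ∧ (b = 0 → (a = 2 ∨ a = -2)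 → F = Multiset.replicate 5 v.residueCard) ∧ (b = 0 → a = 0 → F = {v.residueCard ^ 2, v.residueCard ^ 2, v.residueCard}) ∧ (b = 0 → (a = 1 ∨ a = -1) → F = {v.residueCard ^ 3, v.residueCard, v.residueCard}) ∧ (((a = 0 ∧ (b = 1 ∨ b = -1)) ∨ (a = 1 ∧ b = -1) ∨ (a = -1 ∧ b = 1)) → F = {v.residueCard ^ 5})) → ∃ σ₀ : Literature.NumberTheory.GaloisRepresentations.FramedGaloisRep ℚ ℂ 2, σ₀.toGaloisRep.IsIrreducible ∧ Nonempty ((Matrix.ProjGenLinGroup.mk.comp σ₀.toMonoidHom).range ≃* alternatingGroup (Fin 5)) ∧ ∀ᶠ v : IsDedekindDomain.HeightOneSpectrum (NumberField.RingOfIntegers ℚ) in Filter.cofinite, ∃ α : Multiset ℂ, π.1.HasSatakeParamAt v α ∧ σ₀.IsUnramifiedAt v ∧ ∃ e : ℂ, e ^ 2 = 1 ∧ σ₀.HasFrobCharpolyAt v (Literature.NumberTheory.Automorphic.satakePolynomial (α.map fun a => e * a))) → (∀ (hcpt : Literature.NumberTheory.Automorphic.isCompact_glFiniteIntegralLevel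 2 ℚ) (π π' : Literature.NumberTheory.Automorphic.CuspidalAutomorphicRepData 2 ℚ hcpt), ¬ π.1.IsNearlyEquivalent π'.1 → (∀ (K : Type) [Field K] [NumberField K], Module.finrank ℚ K = 2 → ¬ ∀ᶠ v : IsDedekindDomain.HeightOneSpectrum (NumberField.RingOfIntegers ℚ) in Filter.cofinite, (Ideal.span {((v.residueCard : ℕ) : NumberField.RingOfIntegers K)}).IsPrime → ∀ α : Multiset ℂ, π.1.HasSatakeParamAt v α → π.1.HasSatakeParamAt v (α.map fun a => -a)) → (∀ (K : Type) [Field K] [NumberField K], Module.finrank ℚ K = 2 → ¬ ∀ᶠ v : IsDedekindDomain.HeightOneSpectrum (NumberField.RingOfIntegers ℚ) in Filter.cofinite, (Ideal.span {((v.residueCard : ℕ) : NumberField.RingOfIntegers K)}).IsPrime → ∀ α : Multiset ℂ, π'.1.HasSatakeParamAt v α → π'.1.HasSatakeParamAt v (α.map fun a => -a)) → (∀ᶠ v : IsDedekindDomain.HeightOneSpectrum (NumberField.RingOfIntegers ℚ) in Filter.cofinite, ∃ α α' : Multiset ℂ, π.1.HasSatakeParamAt v α ∧ π'.1.HasSatakeParamAt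 v α' ∧ α.prod = 1 ∧ α'.prod = 1 ∧ ∃ a b : ℤ, α.sum = (a : ℂ) + (b : ℂ) * ((1 + (Real.sqrt 5 : ℂ)) / 2) ∧ α'.sum = (a : ℂ) + (b : ℂ) * ((1 - (Real.sqrt 5 : ℂ)) / 2) ∧ ((b = 0 ∧ (a = 0 ∨ a = 1 ∨ a = -1 ∨ a = 2 ∨ a = -2)) ∨ (b = 1 ∧ (a = 0 ∨ a = -1)) ∨ (b = -1 ∧ (a = 0 ∨ a = 1)))) → (∀ᶠ v : IsDedekindDomain.HeightOneSpectrum (NumberField.RingOfIntegers ℚ) in Filter.cofinite, (∀ α : Multiset ℂ, π.1.HasSatakeParamAt v α → ∀ a ∈ α, ‖a‖ = 1) ∧ (∀ α' : Multiset ℂ, π'.1.HasSatakeParamAt v α' → ∀ a ∈ α', ‖a‖ = 1)) → ∀ σ₀ : Literature.NumberTheory.GaloisRepresentations.FramedGaloisRep ℚ ℂ 2, σ₀.toGaloisRep.IsIrreducible → Nonempty ((Matrix.ProjGenLinGroup.mk.comp σ₀.toMonoidHom).range ≃* alternatingGroup (Fin 5)) → (∀ᶠ v : IsDedekindDomain.HeightOneSpectrum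 (NumberField.RingOfIntegers ℚ) in Filter.cofinite, ∃ α : Multiset ℂ, π.1.HasSatakeParamAt v α ∧ σ₀.IsUnramifiedAt v ∧ ∃ e : ℂ, e ^ 2 = 1 ∧ σ₀.HasFrobCharpolyAt v (Literature.NumberTheory.Automorphic.satakePolynomial (α.map fun a => e * a))) → ∃ χ : Field.absoluteGaloisGroup ℚ →ₜ* ℂˣ, ∀ᶠ v : IsDedekindDomain.HeightOneSpectrum (NumberField.RingOfIntegers ℚ) in Filter.cofinite, ∃ α : Multiset ℂ, π.1.HasSatakeParamAt v α ∧ σ₀.IsUnramifiedAt v ∧ (∀ 𝔓 ∈ v.primesAbove, ∀ g ∈ 𝔓.inertia (Field.absoluteGaloisGroup ℚ), χ g = 1) ∧ ∃ e : ℂ, e ^ 2 = 1 ∧ (∀ 𝔓 ∈ v.primesAbove, ∀ g : Field.absoluteGaloisGroup ℚ, IsArithFrobAt (NumberField.RingOfIntegers ℚ) g 𝔓 → ((χ g : ℂˣ) : ℂ) = e) ∧ σ₀.HasFrobCharpolyAt v (Literature.NumberTheory.Automorphic.satakePolynomial (α.map fun a => e * a))) → Summit.Langlands.Langlands.Theses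.E8QuinticResidue.NoChimeras
  intro h1 h2 hcpt π π' hne hnd hnd' hB hT K _ _ hK hP
  -- (1) Booker's alphabet at almost every place, from temperedness (`alphabet_of_norm_eq_one`)
  have hA : ∀ᶠ v : HeightOneSpectrum (𝓞 ℚ) in cofinite, ∃ α α' : Multiset ℂ,
      π.1.HasSatakeParamAt v α ∧ π'.1.HasSatakeParamAt v α' ∧ α.prod = 1 ∧ α'.prod = 1 ∧
      ∃ a b : ℤ, α.sum = (a : ℂ) + (b : ℂ) * ((1 + (Real.sqrt 5 : ℂ)) / 2) ∧
        α'.sum = (a : ℂ) + (b : ℂ) * ((1 - (Real.sqrt 5 : ℂ)) / 2) ∧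
        ((b = 0 ∧ (a = 0 ∨ a = 1 ∨ a = -1 ∨ a = 2 ∨ a = -2)) ∨ (b = 1 ∧ (a = 0 ∨ a = -1)) ∨
          (b = -1 ∧ (a = 0 ∨ a = 1))) := by
    filter_upwards [hB, hT] with v hBv hTv
    obtain ⟨α, α', hα, hα', hp, hp', a, b, hs, hs'⟩ := hBv
    exact ⟨α, α', hα, hα', hp, hp', a, b, hs, hs',
      alphabet_of_norm_eq_one hα.card_eq hα'.card_eq (hTv.1 α hα) (hTv.2 α' hα') hs hs'⟩
  -- (2) the icosahedral shadow σ₀ of π built from the quintic field K (piece X1)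
  obtain ⟨σ₀, hirr, hico, hM⟩ := h1 hcpt π π' hne hnd hnd' hA hT K hK hP
  -- (3) its sign character χ (piece X2)
  obtain ⟨χ, hχ⟩ := h2 hcpt π π' hne hnd hnd' hA hT σ₀ hirr hico hM
  -- (4) σ := σ₀ ⊗ χ is irreducible, icosahedral, unramified a.e. and has the Satake char-polys
  refine ⟨FramedRep.twist σ₀ χ, isIrreducible_toGaloisRep_twist σ₀ χ hirr, ?_, ?_⟩
  · rw [range_mk_comp_twist]
    exact hico
  · filter_upwards [hχ] with v hv
    obtain ⟨α, hα, hur, hχur, e, he, hχe, hcp⟩ := hv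
    exact ⟨α, hα, FramedGaloisRep.isUnramifiedAt_twist hur hχur,
      hasFrobCharpolyAt_twist_satake he hcp hχe⟩

end Summit.Langlands.Langlands.Cruxes.NoChimeras.ShadowSign

end
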